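import Summits.CriticalPhenomena.SAWScalingLimit.Theorems.SAWLeftRightFKGLeftRightFKGDefs
import Summits.CriticalPhenomena.SAWScalingLimit.Theorems.LeftRightFKG.Negative.BoxDomain
import HarnessLib

/-!
# Stub `stub_loopWindVanish` of line `corner-localisation`

Crux `LeftRightFKG` (stmt-CriticalPhenomena-11232), vocabulary module
`Summits.CriticalPhenomena.SAWScalingLimit.Theorems.SAWLeftRightFKGLeftRightFKGDefs`.

The simple-connectivity input of the line: a closed walk `L` of the discrete domain `Ω_1`,
`Ω = dom C 1 = {z | wind(C, z) ≠ 0}`, does not wind about any point off `Ω`.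

Proof. Let `T` be the trace of (the closed lattice polyline of) `C`; points of `T` have the junk
index `0`, so `Ω ∩ T = ∅`.
* (lattice geometry) two unit lattice segments sharing a point share an endpoint of the first lying
  on the second (`disjoint_segment_of_not_mem`); as the vertices of `L` lie in `Ω` and the vertices
  of `C` lie on `T`, the trace of `L` misses `T` (`range_poly_subset_compl`), hence lies in ONE
  complementary component `W` of `T`, on which the index is constant and non-zero: `W ⊆ Ω`.
* (plane topology) `T` is compact and connected, so `ℂ ∖ W` is preconnected
  (`isPreconnected_compl_connectedComponentIn`: every other complementary component has a frontier
  point, which lies on `T`). A point `z ∉ Ω` and a far point `w` both lie in `ℂ ∖ W ⊆ ℂ ∖ trace L`,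
  so `z` is joined to `w` off the trace of `L` and `wind(L, z) = wind(L, w) = 0`
  (`wind_sub_eq_zero_of_joined`).
-/

noncomputable section

open Set Literature.Probability.LatticeModels Literature.Probability.RandomPlanarGeometry
open Literature.Topology.PlaneTopology
open Summit.CriticalPhenomena.SAWScalingLimit.Theorems.LeftRightFKG.Negative

namespace Summit.CriticalPhenomena.SAWScalingLimit.Theorems.LeftRightFKG.CornerLoc

/-! ## Unit lattice segments sharing a point -/

/-- A point of a unit lattice segment whose real part lies strictly between `m` and `m + 1`:
the segment is the horizontal one `[m, m + 1] × {p 1}` through it. [folklore] -/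
theorem horiz_of_mem_segment {p q : Site 2} (h : (zdGraph 2).Adj p q) {z : ℂ}
    (hz : z ∈ segment ℝ (pt p) (pt q)) {m : ℤ} (h1 : (m : ℝ) < z.re) (h2 : z.re < m + 1) :
    q 1 = p 1 ∧ z.im = p 1 ∧ ((p 0 = m ∧ q 0 = m + 1) ∨ (p 0 = m + 1 ∧ q 0 = m)) := by
  rcases adj_cases h with ⟨h0, h1'⟩ | ⟨h0, h1'⟩ | ⟨-, h0⟩ | ⟨-, h0⟩
  · refine ⟨h1', im_eq_of_mem_segment h1' hz, Or.inl ?_⟩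
    obtain ⟨hlo, hhi⟩ := re_mem_of_mem_segment hz
    rw [pt_re, pt_re, h0] at hlo hhi
    push_cast at hlo hhi
    rw [min_eq_left (by linarith)] at hlo
    rw [max_eq_right (by linarith)] at hhi
    have e1 : m < p 0 + 1 := by exact_mod_cast (by linarith : (m : ℝ) < p 0 + 1)
    have e2 : p 0 < m + 1 := by exact_mod_cast (by linarith : (p 0 : ℝ) < m + 1)
    omega
  · refine ⟨h1', im_eq_of_mem_segment h1' hz, Or.inr ?_⟩
    obtain ⟨hlo, hhi⟩ := re_mem_of_mem_segment hz
    rw [pt_re, pt_re, h0] at hlo hhi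
    push_cast at hlo hhi
    rw [min_eq_right (by linarith)] at hlo
    rw [max_eq_left (by linarith)] at hhi
    have e1 : m < q 0 + 1 := by exact_mod_cast (by linarith : (m : ℝ) < q 0 + 1)
    have e2 : q 0 < m + 1 := by exact_mod_cast (by linarith : (q 0 : ℝ) < m + 1)
    omega
  · exfalso
    rw [re_eq_of_mem_segment h0 hz] at h1 h2
    have e1 : m < p 0 := by exact_mod_cast h1
    have e2 : p 0 < m + 1 := by exact_mod_cast h2
    omega
  · exfalso
    rw [re_eq_of_mem_segment h0 hz] at h1 h2
    have e1 : m < p 0 := by exact_mod_cast h1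
    have e2 : p 0 < m + 1 := by exact_mod_cast h2
    omega

/-- A point of a unit lattice segment whose imaginary part lies strictly between `k` and `k + 1`:
the segment is the vertical one `{p 0} × [k, k + 1]` through it. [folklore] -/
theorem vert_of_mem_segment {p q : Site 2} (h : (zdGraph 2).Adj p q) {z : ℂ}
    (hz : z ∈ segment ℝ (pt p) (pt q)) {k : ℤ} (h1 : (k : ℝ) < z.im) (h2 : z.im < k + 1) :
    q 0 = p 0 ∧ z.re = p 0 ∧ ((p 1 = k ∧ q 1 = k + 1) ∨ (p 1 = k + 1 ∧ q 1 = k)) := by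
  rcases adj_cases h with ⟨-, h1'⟩ | ⟨-, h1'⟩ | ⟨h1', h0⟩ | ⟨h1', h0⟩
  · exfalso
    rw [im_eq_of_mem_segment h1' hz] at h1 h2
    have e1 : k < p 1 := by exact_mod_cast h1
    have e2 : p 1 < k + 1 := by exact_mod_cast h2
    omega
  · exfalso
    rw [im_eq_of_mem_segment h1' hz] at h1 h2
    have e1 : k < p 1 := by exact_mod_cast h1
    have e2 : p 1 < k + 1 := by exact_mod_cast h2
    omega
  · refine ⟨h0, re_eq_of_mem_segment h0 hz, Or.inl ?_⟩
    obtain ⟨hlo, hhi⟩ := im_mem_of_mem_segment hz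
    rw [pt_im, pt_im, h1'] at hlo hhi
    push_cast at hlo hhi
    rw [min_eq_left (by linarith)] at hlo
    rw [max_eq_right (by linarith)] at hhi
    have e1 : k < p 1 + 1 := by exact_mod_cast (by linarith : (k : ℝ) < p 1 + 1)
    have e2 : p 1 < k + 1 := by exact_mod_cast (by linarith : (p 1 : ℝ) < k + 1)
    omega
  · refine ⟨h0, re_eq_of_mem_segment h0 hz, Or.inr ?_⟩
    obtain ⟨hlo, hhi⟩ := im_mem_of_mem_segment hz
    rw [pt_im, pt_im, h1'] at hlo hhi
    push_cast at hlo hhi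
    rw [min_eq_right (by linarith)] at hlo
    rw [max_eq_left (by linarith)] at hhi
    have e1 : k < q 1 + 1 := by exact_mod_cast (by linarith : (k : ℝ) < q 1 + 1)
    have e2 : q 1 < k + 1 := by exact_mod_cast (by linarith : (q 1 : ℝ) < k + 1)
    omega

/-- A non-endpoint point of a unit lattice segment has a coordinate strictly between two
consecutive integers. [folklore] -/
theorem exists_strict_of_mem_segment {p q : Site 2} (h : (zdGraph 2).Adj p q) {z : ℂ}
    (hz : z ∈ segment ℝ (pt p) (pt q)) (hp : z ≠ pt p) (hq : z ≠ pt q) :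
    (∃ m : ℤ, (m : ℝ) < z.re ∧ z.re < m + 1) ∨ (∃ k : ℤ, (k : ℝ) < z.im ∧ z.im < k + 1) := by
  rcases adj_cases h with ⟨h0, h1⟩ | ⟨h0, h1⟩ | ⟨h1, h0⟩ | ⟨h1, h0⟩
  · have him := im_eq_of_mem_segment h1 hz
    obtain ⟨hlo, hhi⟩ := re_mem_of_mem_segment hz
    rw [pt_re, pt_re, h0] at hlo hhi
    push_cast at hlo hhi
    rw [min_eq_left (by linarith)] at hlo
    rw [max_eq_right (by linarith)] at hhi
    refine Or.inl ⟨p 0, lt_of_le_of_ne hlo fun he => hp ?_, lt_of_le_of_ne hhi fun he => hq ?_⟩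
    · exact Complex.ext (by rw [pt_re, he]) (by rw [pt_im, him])
    · exact Complex.ext (by rw [pt_re, h0, he]; push_cast; ring) (by rw [pt_im, him, h1])
  · have him := im_eq_of_mem_segment h1 hz
    obtain ⟨hlo, hhi⟩ := re_mem_of_mem_segment hz
    rw [pt_re, pt_re, h0] at hlo hhi
    push_cast at hlo hhi
    rw [min_eq_right (by linarith)] at hlo
    rw [max_eq_left (by linarith)] at hhi
    refine Or.inl ⟨q 0, lt_of_le_of_ne hlo fun he => hq ?_, lt_of_le_of_ne hhi fun he => hp ?_⟩
    · exact Complex.ext (by rw [pt_re, he]) (by rw [pt_im, him, h1])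
    · exact Complex.ext (by rw [pt_re, h0, he]; push_cast; ring) (by rw [pt_im, him])
  · have hre := re_eq_of_mem_segment h0 hz
    obtain ⟨hlo, hhi⟩ := im_mem_of_mem_segment hz
    rw [pt_im, pt_im, h1] at hlo hhi
    push_cast at hlo hhi
    rw [min_eq_left (by linarith)] at hlo
    rw [max_eq_right (by linarith)] at hhi
    refine Or.inr ⟨p 1, lt_of_le_of_ne hlo fun he => hp ?_, lt_of_le_of_ne hhi fun he => hq ?_⟩
    · exact Complex.ext (by rw [pt_re, hre]) (by rw [pt_im, he])
    · exact Complex.ext (by rw [pt_re, hre, h0]) (by rw [pt_im, h1, he]; push_cast; ring)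
  · have hre := re_eq_of_mem_segment h0 hz
    obtain ⟨hlo, hhi⟩ := im_mem_of_mem_segment hz
    rw [pt_im, pt_im, h1] at hlo hhi
    push_cast at hlo hhi
    rw [min_eq_right (by linarith)] at hlo
    rw [max_eq_left (by linarith)] at hhi
    refine Or.inr ⟨q 1, lt_of_le_of_ne hlo fun he => hq ?_, lt_of_le_of_ne hhi fun he => hp ?_⟩
    · exact Complex.ext (by rw [pt_re, hre, h0]) (by rw [pt_im, he])
    · exact Complex.ext (by rw [pt_re, hre]) (by rw [pt_im, h1, he]; push_cast; ring)

/-- The lattice points of a unit lattice segment are its two endpoints. [folklore] -/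
theorem pt_eq_of_mem_segment {p q : Site 2} (h : (zdGraph 2).Adj p q) {a : Site 2}
    (ha : pt a ∈ segment ℝ (pt p) (pt q)) : pt a = pt p ∨ pt a = pt q := by
  by_contra hne
  rw [not_or] at hne
  rcases exists_strict_of_mem_segment h ha hne.1 hne.2 with ⟨m, hm, hm'⟩ | ⟨k, hk, hk'⟩
  · rw [pt_re] at hm hm'
    have e1 : m < a 0 := by exact_mod_cast hm
    have e2 : a 0 < m + 1 := by exact_mod_cast hm'
    omega
  · rw [pt_im] at hk hk'
    have e1 : k < a 1 := by exact_mod_cast hk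
    have e2 : a 1 < k + 1 := by exact_mod_cast hk'
    omega

/-- **Two unit lattice segments that share a point share an endpoint of the first lying on the
second**: if neither endpoint of `[x, y]` lies on `[p, q]`, the two segments are disjoint.
[folklore] -/
theorem disjoint_segment_of_not_mem {x y p q : Site 2} (hxy : (zdGraph 2).Adj x y)
    (hpq : (zdGraph 2).Adj p q) (hx : pt x ∉ segment ℝ (pt p) (pt q))
    (hy : pt y ∉ segment ℝ (pt p) (pt q)) :
    Disjoint (segment ℝ (pt x) (pt y)) (segment ℝ (pt p) (pt q)) := by
  rw [Set.disjoint_left]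
  intro z hz hz'
  have hzx : z ≠ pt x := fun he => hx (he ▸ hz')
  have hzy : z ≠ pt y := fun he => hy (he ▸ hz')
  have hp : pt p ∈ segment ℝ (pt p) (pt q) := left_mem_segment _ _ _
  have hq : pt q ∈ segment ℝ (pt p) (pt q) := right_mem_segment _ _ _
  rcases exists_strict_of_mem_segment hxy hz hzx hzy with ⟨m, hm, hm'⟩ | ⟨k, hk, hk'⟩
  · obtain ⟨-, hzi, hx0⟩ := horiz_of_mem_segment hxy hz hm hm'
    obtain ⟨hq1, hzi', hp0⟩ := horiz_of_mem_segment hpq hz' hm hm'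
    have h11 : x 1 = p 1 := by rw [hzi] at hzi'; exact_mod_cast hzi'
    have h00 : x 0 = p 0 ∨ x 0 = q 0 := by
      rcases hx0 with ⟨ha, -⟩ | ⟨ha, -⟩ <;> rcases hp0 with ⟨hb, hc⟩ | ⟨hb, hc⟩ <;> omega
    rcases h00 with h00 | h00
    · exact hx (by
        rw [show pt x = pt p from
          Complex.ext (by rw [pt_re, pt_re, h00]) (by rw [pt_im, pt_im, h11])]
        exact hp)
    · exact hx (by
        rw [show pt x = pt q from
          Complex.ext (by rw [pt_re, pt_re, h00]) (by rw [pt_im, pt_im, h11, hq1])]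
        exact hq)
  · obtain ⟨-, hzr, hx1⟩ := vert_of_mem_segment hxy hz hk hk'
    obtain ⟨hq0, hzr', hp1⟩ := vert_of_mem_segment hpq hz' hk hk'
    have h00 : x 0 = p 0 := by rw [hzr] at hzr'; exact_mod_cast hzr'
    have h11 : x 1 = p 1 ∨ x 1 = q 1 := by
      rcases hx1 with ⟨ha, -⟩ | ⟨ha, -⟩ <;> rcases hp1 with ⟨hb, hc⟩ | ⟨hb, hc⟩ <;> omega
    rcases h11 with h11 | h11
    · exact hx (by
        rw [show pt x = pt p from
          Complex.ext (by rw [pt_re, pt_re, h00]) (by rw [pt_im, pt_im, h11])]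
        exact hp)
    · exact hx (by
        rw [show pt x = pt q from
          Complex.ext (by rw [pt_re, pt_re, h00, hq0]) (by rw [pt_im, pt_im, h11])]
        exact hq)

/-- A unit lattice segment whose endpoints are off a lattice polyline misses it. [folklore] -/
theorem disjoint_segment_range_poly {x y : Site 2} (hxy : (zdGraph 2).Adj x y) :
    ∀ (a : Site 2) (l : List (Site 2)), List.IsChain (zdGraph 2).Adj (a :: l) →
      pt x ∉ range (poly a l) → pt y ∉ range (poly a l) →
      Disjoint (segment ℝ (pt x) (pt y)) (range (poly a l))
  | a, [], _, hx, hy => by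
    rw [Set.disjoint_right]
    rintro _ ⟨t, rfl⟩ hmem
    have hta : (poly a []) t = pt a := rfl
    rw [hta] at hmem
    rcases pt_eq_of_mem_segment hxy hmem with he | he
    · exact hx ⟨0, (poly a []).source.trans he⟩
    · exact hy ⟨0, (poly a []).source.trans he⟩
  | a, b :: l, hc, hx, hy => by
    rw [List.isChain_cons_cons] at hc
    rw [range_poly_cons] at hx hy ⊢
    rw [Set.mem_union, not_or] at hx hy
    exact Set.disjoint_union_right.2
      ⟨disjoint_segment_of_not_mem hxy hc.1 hx.1 hy.1,
        disjoint_segment_range_poly hxy b l hc.2 hx.2 hy.2⟩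

/-- The trace of a walk of the discrete domain `Ω_1` starting at a point of `Ω` misses every
lattice polyline `T` (the polyline of a lattice chain) that misses `Ω`: the vertices of the walk
lie in `Ω`, hence off `T`, so each of its unit edges misses `T`. [folklore] -/
theorem range_poly_subset_compl {Ω : Set ℂ} {a : Site 2} {l : List (Site 2)}
    (hc : List.IsChain (zdGraph 2).Adj (a :: l)) (hΩ : ∀ z ∈ Ω, z ∉ range (poly a l))
    {u v : Site 2} (L : (discreteDomainGraph Ω 1).Walk u v) (hu : pt u ∈ Ω) :
    range (poly u L.support.tail) ⊆ (range (poly a l))ᶜ := by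
  refine range_poly_subset_of_isChain u _ (hΩ _ hu) ?_
  rw [L.cons_tail_support]
  refine L.isChain_adj_support.imp fun x y hxy => ?_
  obtain ⟨hm, hxD, hyD⟩ := discreteDomainGraph_adj_iff.1 hxy
  have hvert : ∀ w ∈ meshDomain Ω 1, pt w ∈ Ω := fun w hw => by
    have h' := meshDomain_subset_meshVertices _ _ hw
    rwa [mem_meshVertices_iff, meshPoint_one] at h'
  exact (disjoint_segment_range_poly (meshGraph_adj_iff.1 hm).1 a l hc (hΩ _ (hvert x hxD))
    (hΩ _ (hvert y hyD))).subset_compl_right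

/-! ## Plane topology: the complement of a complementary component of a continuum -/

/-- For a closed preconnected nonempty `T ⊆ ℂ` and a complementary component `W` of `T`, the
complement `ℂ ∖ W` is preconnected: it is the union of `T` and the closures of the other
complementary components, each of which is preconnected and has a frontier point on `T`.
[folklore] -/
theorem isPreconnected_compl_connectedComponentIn {T : Set ℂ} (hT : IsClosed T)
    (hTc : IsPreconnected T) {t₀ : ℂ} (ht₀ : t₀ ∈ T) (x : ℂ) :
    IsPreconnected (connectedComponentIn Tᶜ x)ᶜ := by
  have hTW : T ⊆ (connectedComponentIn Tᶜ x)ᶜ :=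
    Set.subset_compl_comm.1 (connectedComponentIn_subset _ _)
  refine isPreconnected_of_forall t₀ fun p hp => ?_
  have hVW : connectedComponentIn Tᶜ p ⊆ (connectedComponentIn Tᶜ x)ᶜ := by
    intro q hqV hqW
    have hpT : p ∈ Tᶜ := connectedComponentIn_nonempty_iff.1 ⟨q, hqV⟩
    apply hp
    rw [connectedComponentIn_eq hqW, ← connectedComponentIn_eq hqV]
    exact mem_connectedComponentIn hpT
  have hcl : closure (connectedComponentIn Tᶜ p) ⊆ (connectedComponentIn Tᶜ x)ᶜ :=
    (closure_connectedComponentIn_compl_subset hT p).trans (Set.union_subset hVW hTW)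
  refine ⟨T ∪ closure (connectedComponentIn Tᶜ p), Set.union_subset hTW hcl, Or.inl ht₀, ?_, ?_⟩
  · by_cases hpT : p ∈ T
    · exact Or.inl hpT
    · exact Or.inr (subset_closure (mem_connectedComponentIn hpT))
  · rcases (connectedComponentIn Tᶜ p).eq_empty_or_nonempty with hVe | hVne
    · rw [hVe, closure_empty, Set.union_empty]
      exact hTc
    · have hVu : connectedComponentIn Tᶜ p ≠ univ := by
        intro he
        have ht : t₀ ∈ connectedComponentIn Tᶜ p := by rw [he]; exact Set.mem_univ _
        exact connectedComponentIn_subset _ _ ht ht₀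
      obtain ⟨q, hq⟩ := nonempty_frontier_iff.2 ⟨hVne, hVu⟩
      exact hTc.union q (Janiszewski.frontier_connectedComponentIn_subset hT p hq)
        (frontier_subset_closure hq) isPreconnected_connectedComponentIn.closure

/-! ## The stub -/

/-- **LOOP WINDING VANISHES OFF THE DOMAIN** (registered stub `stub_loopWindVanish` of line
`corner-localisation`): a closed walk of the discrete domain `Ω_1`, `Ω = dom C 1`, has winding
number `0` about every point not in `Ω`. [folklore] -/
theorem stub_loopWindVanish : LoopWindVanish := by
  intro c u C L z hz
  have hdom : ∀ q : ℂ, q ∈ dom C 1 ↔ wind (fun t => (poly c C.support.tail).extend t - q) ≠ 0 :=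
    fun q => by simp only [dom, Set.mem_setOf_eq, iccExtend_toCurve_apply]
  have hvert : ∀ w ∈ meshDomain (dom C 1) 1, pt w ∈ dom C 1 := fun w hw => by
    have h' := meshDomain_subset_meshVertices _ _ hw
    rwa [mem_meshVertices_iff, meshPoint_one] at h'
  by_cases hu : pt u ∈ dom C 1
  swap
  · -- off `Ω` there are no edges: `L` is trivial and its loop is constant
    cases L with
    | nil =>
      simp only [iccExtend_toCurve_apply]
      show wind (fun t => (Path.refl (pt u)).extend t - z) = 0
      simp only [Path.refl_extend, ContinuousMap.const_apply]
      exact wind_const _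
    | cons h _ =>
      exact absurd (hvert u (discreteDomainGraph_adj_iff.1 h).2.1) hu
  simp only [iccExtend_toCurve_apply]
  set PC := poly c C.support.tail with hPC
  set PL := poly u L.support.tail with hPL
  -- the trace `T = range PC` of `C`
  have hchainC : List.IsChain (zdGraph 2).Adj (c :: C.support.tail) :=
    isChain_support (fun _ _ h => h) C
  have h01C : PC.extend 0 = PC.extend 1 := by
    rw [Path.extend_zero, Path.extend_one, poly_fst_walk C]
  have hTcl : IsClosed (range PC) := (isCompact_range PC.continuous).isClosed
  have hmapsC : MapsTo PC.extend (Icc 0 1) (range PC) := fun t ht => by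
    rw [Path.extend_apply PC ht]; exact ⟨_, rfl⟩
  have hΩT : ∀ q ∈ dom C 1, q ∉ range PC := fun q hq hqT =>
    (hdom q).1 hq (wind_eq_zero_of_mem_range PC hqT)
  -- the trace of `L` misses `T`, hence lies in the component `W` of `pt u`, and `W ⊆ Ω`
  have hLT : range PL ⊆ (range PC)ᶜ := range_poly_subset_compl hchainC hΩT L hu
  have hLW : range PL ⊆ connectedComponentIn (range PC)ᶜ (pt u) :=
    (isPreconnected_range PL.continuous).subset_connectedComponentIn ⟨0, PL.source⟩ hLT
  have hWΩ : connectedComponentIn (range PC)ᶜ (pt u) ⊆ dom C 1 := fun q hq => by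
    rw [hdom, ← wind_sub_eq_of_mem_connectedComponentIn PC.continuous_extend.continuousOn h01C hTcl
      hmapsC hq]
    exact (hdom _).1 hu
  -- a far point `w = B`, off `Ω`
  obtain ⟨M, hM⟩ := (isCompact_range PL.continuous).isBounded.exists_norm_le
  obtain ⟨R, hR⟩ := (isCompact_range PC.continuous).isBounded.exists_norm_le
  set B : ℝ := max (max M R) 0 + 1 with hB
  have hB0 : 0 ≤ B := by
    have := le_max_right (max M R) 0; rw [hB]; linarith
  have hBM : M < B := by
    have := le_max_left M R; have := le_max_left (max M R) 0; rw [hB]; linarith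
  have hBR : R < B := by
    have := le_max_right M R; have := le_max_left (max M R) 0; rw [hB]; linarith
  have hnorm : ‖((B : ℝ) : ℂ)‖ = B := by
    rw [Complex.norm_real, Real.norm_eq_abs, abs_of_nonneg hB0]
  have hw : ((B : ℝ) : ℂ) ∉ dom C 1 := by
    rw [hdom, not_not]
    refine wind_sub_eq_zero_of_dist_le PC.continuous_extend.continuousOn h01C (x := 0) (r := R)
      (fun t ht => ?_) ?_
    · rw [dist_zero_right, Path.extend_apply PC ht]; exact hR _ ⟨_, rfl⟩
    · rw [dist_zero_right, hnorm]; exact hBR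
  -- `ℂ ∖ W` is preconnected, contains `z` and `w`, and misses the trace of `L`
  have hWc : IsPreconnected (connectedComponentIn (range PC)ᶜ (pt u))ᶜ :=
    isPreconnected_compl_connectedComponentIn hTcl (isPreconnected_range PC.continuous)
      ⟨0, PC.source⟩ (pt u)
  have hzW : z ∈ (connectedComponentIn (range PC)ᶜ (pt u))ᶜ := fun h => hz (hWΩ h)
  have hwW : ((B : ℝ) : ℂ) ∈ (connectedComponentIn (range PC)ᶜ (pt u))ᶜ := fun h => hw (hWΩ h)
  have hsub : (connectedComponentIn (range PC)ᶜ (pt u))ᶜ ⊆ (range PL)ᶜ :=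
    Set.compl_subset_compl.2 hLW
  have hjoin : ((B : ℝ) : ℂ) ∈ connectedComponentIn (range PL)ᶜ z :=
    hWc.subset_connectedComponentIn hzW hsub hwW
  -- conclude: `z` is joined to the far point `w` off the trace of `L`
  have h01L : PL.extend 0 = PL.extend 1 := by
    rw [Path.extend_zero, Path.extend_one, poly_fst_walk L]
  exact wind_sub_eq_zero_of_joined PL.continuous_extend.continuousOn h01L
    (isCompact_range PL.continuous).isClosed
    (fun t ht => by rw [Path.extend_apply PL ht]; exact ⟨_, rfl⟩)
    (fun t ht => by rw [Path.extend_apply PL ht]; exact hM _ ⟨_, rfl⟩) (hsub hzW) hjoin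
    (by rw [hnorm]; exact hBM)

end Summit.CriticalPhenomena.SAWScalingLimit.Theorems.LeftRightFKG.CornerLoc

end
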